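import Mathlib
import Summits.NavierStokesRegularity.NavierStokesRegularity.Theorems.L3TimeExponentPincerRingPersistenceHolds
import Summits.NavierStokesRegularity.NavierStokesRegularity.Theorems.L3TimeExponentPincerCritModulus
import HarnessLib.Audit
import HarnessLib

/-!
# L3TimeExponentPincer — ring persistence WITH CONTROLLED DATA: `L3PersistenceWithData (1/2) 2`,
# hence the modulus lower bound of every data-critical jaw is unconditional (rings calibrate `A^{q-4}`)

Support kernel for the crux `L3CascadeJaw` (item stmt-NavierStokesRegularity-19499); sequel of
`…RingPersistenceHolds` (`LpPersistence 3 (1/2) 2`).  The typed node `L3PersistenceWithData β a`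
of `…QuantJaw` asks, on top of `LpPersistence 3 β a`, that the data of the family satisfy
`‖u₀‖₃ ≤ C₀ ℓ^{-β}`.  For the explicit glued-dipole ring datum this is the interpolation
`∫|u₀|³ ≤ ‖u₀‖_∞ ∫|u₀|²` (`…CritModulus.eLpNorm_three_rpow_le_of_top_two`) with the sup bound
`‖u₀‖_∞ ≤ 4κ/t⁶` (`norm_ringField_sq_le_max`: `‖u₀‖² ≤ (104/9)κ²/max(t⁴,|x|²)³ ≤ 16κ²/t¹²`) and the
energy normalisation `∫|u₀|² ≤ 1`: `‖u₀‖₃ ≤ (4κ/t⁶)^{1/3} = (4c_E)^{1/3} ℓ^{-1/2}` (`κ = c_E t³`,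
`ℓ = t²`).

* `ringDatum_norm_le`, `ringDatum_eLpNorm_top_le`, `ringDatum_eLpNorm_three_le` — the datum bounds;
* `l3PersistenceWithData_of_ringData` — the packaging theorem (the interface of
  `lpPersistence_of_ringData` plus the `L³` clause);
* `l3PersistenceWithData_three_half_two : L3PersistenceWithData (1/2) 2`;
* `quantJawData_modulus_lower_ring` — `quantJawData_modulus_lower` made unconditional at
  `β = 1/2`, `a = 2`: every bound `B` admissible for the data-critical jaw on the slice
  `{ν = T = 1, E₀ ≤ 1, ‖u₀‖₃ ≤ C₀ℓ^{-1/2}}` has `B ≥ c^{q+1} ℓ^{-(q/2 − 2)}` — with `A = C₀ℓ^{-1/2}`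
  the modulus of `QuantJawData q` grows at least like `A^{q-4}` (all `q ≥ 0`).

WHAT THIS IS NOT: not NS regularity or blow-up; a calibration of the surviving quantitative rung
`QuantJawData` by explicit smooth global (swirl-free axisymmetric) solutions; the crux
`L3CascadeJaw` is untouched; no crux claim.
-/

namespace Summit.NavierStokesRegularity.NavierStokesRegularity.Theorems.L3TimeExponentPincerRingPersistenceData

open Real Set Metric MeasureTheory Literature.Analysis.FluidPDE Literature.Analysis.Calculus
open Summit.NavierStokesRegularity.NavierStokesRegularity.Theorems.L3TimeExponentPincerQuantJaw
open Summit.NavierStokesRegularity.NavierStokesRegularity.Theorems.L3TimeExponentPincerRingPersistenceFloor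
open Summit.NavierStokesRegularity.NavierStokesRegularity.Theorems.L3TimeExponentPincerRingPersistenceHolds
open Summit.NavierStokesRegularity.NavierStokesRegularity.Theorems.L3TimeExponentPincerRingDatumBounds
open Summit.NavierStokesRegularity.NavierStokesRegularity.Theorems.L3TimeExponentPincerRingDatumEnergy
open Summit.NavierStokesRegularity.NavierStokesRegularity.Theorems.L3TimeExponentPincerRingDatumShape
open Summit.NavierStokesRegularity.NavierStokesRegularity.Theorems.L3TimeExponentPincerRingDatumPotential
open Summit.NavierStokesRegularity.NavierStokesRegularity.Theorems.L3TimeExponentPincerRingDatumSpeedBound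
open Summit.NavierStokesRegularity.NavierStokesRegularity.Theorems.L3TimeExponentPincerRingDatumDecayIntegral
open Summit.NavierStokesRegularity.NavierStokesRegularity.Theorems.L3TimeExponentPincerCritModulus
open scoped ENNReal ContDiff Topology

variable {G F : ℝ → ℝ} {κ t : ℝ}

/-! ### A. The `L^∞` and `L³` size of the ring datum -/

/-- **Sup bound**: `‖u₀(x)‖ ≤ 4κ/t⁶` (from `‖u₀‖² ≤ (104/9)κ²/max(t⁴,|x|²)³ ≤ 16κ²/t¹²`). -/
theorem ringDatum_norm_le
    (hG : G = fun s => -κ * (Real.smoothTransition (s / t ^ 4 - 1) - Real.smoothTransition (s / 16 - 1)))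
    (hF : F = fun s => ∫ τ in (32 : ℝ)..s, τ ^ (-(5 / 2 : ℝ)) * G τ) (ht : 0 < t) (ht1 : t ≤ 1)
    (hκ : 0 ≤ κ) (x : EuclideanSpace ℝ (Fin 3)) :
    ‖curl (fun y : EuclideanSpace ℝ (Fin 3) => F (‖y‖ ^ 2) • rotGen y) x‖ ≤ 4 * κ / t ^ 6 := by
  obtain ⟨ht4, hab, -⟩ := core_scale_bounds ht ht1
  obtain ⟨hGs, hGa, hGR, hFs, -, -⟩ := potential_facts hG hF ht ht1
  have hK : ∀ τ, |G τ| ≤ κ := fun τ => abs_shape_le hG hκ ht4 hab τ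
  have hFd : Differentiable ℝ F := hFs.differentiable (by simp)
  have h₁ : ∀ s, t ^ 4 ≤ s → |deriv F s| ≤ κ * s ^ (-(5 / 2 : ℝ)) := by
    intro s hs; rw [hF]; exact abs_deriv_potential_le hGs ht4 hGa hK (ht4.le.trans hs)
  have h₁' : ∀ s, s < t ^ 4 → deriv F s = 0 := by
    intro s hs; rw [hF]; exact deriv_potential_eq_zero_of_le hGs ht4 hGa hs.le
  have h₀ : ∀ s, t ^ 4 ≤ s → |F s| ≤ (2 * κ / 3) * s ^ (-(3 / 2 : ℝ)) := by
    intro s hs; rw [hF]; exact abs_potential_le_of_ge ht4 hK hGR hs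
  have h₀' : ∀ s, s < t ^ 4 → |F s| ≤ (2 * κ / 3) * (t ^ 4) ^ (-(3 / 2 : ℝ)) := by
    intro s hs; rw [hF]; exact abs_potential_le_of_le hGs ht4 hGa hK hGR hs.le
  have hsq := norm_ringField_sq_le_max hFd ht4 h₁ h₁' h₀ h₀' x
  -- `1/max(t⁴, s)³ ≤ 1/t¹²`
  have hmax : ((max (t ^ 4) (‖x‖ ^ 2)) ^ 3)⁻¹ ≤ ((t ^ 4) ^ 3)⁻¹ :=
    inv_anti₀ (pow_pos ht4 3) (pow_le_pow_left₀ ht4.le (le_max_left _ _) 3)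
  have hsq' : ‖curl (fun y : EuclideanSpace ℝ (Fin 3) => F (‖y‖ ^ 2) • rotGen y) x‖ ^ 2 ≤
      (4 * κ / t ^ 6) ^ 2 := by
    have ht0 : t ≠ 0 := ht.ne'
    calc ‖curl (fun y : EuclideanSpace ℝ (Fin 3) => F (‖y‖ ^ 2) • rotGen y) x‖ ^ 2
        ≤ (104 / 9) * κ ^ 2 * ((t ^ 4) ^ 3)⁻¹ :=
          hsq.trans (mul_le_mul_of_nonneg_left hmax (by positivity))
      _ ≤ 16 * κ ^ 2 * ((t ^ 4) ^ 3)⁻¹ := by gcongr; norm_num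
      _ = (4 * κ / t ^ 6) ^ 2 := by field_simp; ring
  exact (pow_le_pow_iff_left₀ (norm_nonneg _) (by positivity) two_ne_zero).1 hsq'

/-- **`‖u₀‖_{L^∞} ≤ 4κ/t⁶`.** -/
theorem ringDatum_eLpNorm_top_le
    (hG : G = fun s => -κ * (Real.smoothTransition (s / t ^ 4 - 1) - Real.smoothTransition (s / 16 - 1)))
    (hF : F = fun s => ∫ τ in (32 : ℝ)..s, τ ^ (-(5 / 2 : ℝ)) * G τ) (ht : 0 < t) (ht1 : t ≤ 1)
    (hκ : 0 ≤ κ) :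
    eLpNorm (curl fun y : EuclideanSpace ℝ (Fin 3) => F (‖y‖ ^ 2) • rotGen y) ∞ volume ≤
      ENNReal.ofReal (4 * κ / t ^ 6) := by
  rw [eLpNorm_exponent_top]
  exact eLpNormEssSup_le_of_ae_bound
    (Filter.Eventually.of_forall fun x => ringDatum_norm_le hG hF ht ht1 hκ x)

/-- **`‖u₀‖_{L³} ≤ (4κ/t⁶)^{1/3}`** when the energy is normalised (`∫⁻‖u₀‖ₑ² ≤ 1`):
interpolation `‖f‖₃ ≤ ‖f‖_∞^{1/3} (∫|f|²)^{1/3}`. -/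
theorem ringDatum_eLpNorm_three_le
    (hG : G = fun s => -κ * (Real.smoothTransition (s / t ^ 4 - 1) - Real.smoothTransition (s / 16 - 1)))
    (hF : F = fun s => ∫ τ in (32 : ℝ)..s, τ ^ (-(5 / 2 : ℝ)) * G τ) (ht : 0 < t) (ht1 : t ≤ 1)
    (hκ : 0 ≤ κ)
    (hE1 : ∫⁻ x, ‖curl (fun y : EuclideanSpace ℝ (Fin 3) => F (‖y‖ ^ 2) • rotGen y) x‖ₑ ^ 2 ≤ 1) :
    eLpNorm (curl fun y : EuclideanSpace ℝ (Fin 3) => F (‖y‖ ^ 2) • rotGen y) 3 volume ≤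
      ENNReal.ofReal ((4 * κ / t ^ 6) ^ (1 / 3 : ℝ)) := by
  obtain ⟨hsm, -, -, -, -⟩ := ringDatum_frame hG hF ht ht1
  have hmeas : AEStronglyMeasurable (curl fun y : EuclideanSpace ℝ (Fin 3) => F (‖y‖ ^ 2) • rotGen y)
      volume := hsm.continuous.aestronglyMeasurable
  have h := eLpNorm_three_rpow_le_of_top_two (μ := volume) hmeas (q := 1) zero_le_one
  rw [ENNReal.rpow_one] at h
  refine h.trans ?_
  calc eLpNorm (curl fun y : EuclideanSpace ℝ (Fin 3) => F (‖y‖ ^ 2) • rotGen y) ∞ volume ^ ((1 : ℝ) / 3) *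
        (∫⁻ x, ‖curl (fun y : EuclideanSpace ℝ (Fin 3) => F (‖y‖ ^ 2) • rotGen y) x‖ₑ ^ 2) ^ ((1 : ℝ) / 3)
      ≤ ENNReal.ofReal (4 * κ / t ^ 6) ^ ((1 : ℝ) / 3) * 1 ^ ((1 : ℝ) / 3) := by
        gcongr
        · exact ringDatum_eLpNorm_top_le hG hF ht ht1 hκ
    _ = ENNReal.ofReal ((4 * κ / t ^ 6) ^ (1 / 3 : ℝ)) := by
        rw [ENNReal.one_rpow, mul_one, ENNReal.ofReal_rpow_of_nonneg (by positivity) (by norm_num)]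

/-! ### B. Packaging: `L3PersistenceWithData (1/2) 2` from a ring datum family with `L³` control -/

/-- **`L3PersistenceWithData (1/2) 2` from a ring datum family with controlled data.**  The
interface of `lpPersistence_of_ringData` (constant `c ∈ (0,1]`, and for every `ℓ ∈ (0,1]` a
smooth divergence-free rapidly decaying axisymmetric swirl-free datum with the seventeen datum
bounds and the three scale inequalities) plus `0 < C₀` and the datum clause
`‖u₀‖₃ ≤ C₀ ℓ^{-1/2}` gives `L3PersistenceWithData (1/2) 2` (same Tao-class solution; `u 0 = u₀`). -/
theorem l3PersistenceWithData_of_ringData {c C₀ : ℝ} (hc : 0 < c) (hc1 : c ≤ 1) (hC₀ : 0 < C₀)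
    (hdata : ∀ ℓ : ℝ, 0 < ℓ → ℓ ≤ 1 →
      ∃ (u₀ : EuclideanSpace ℝ (Fin 3) → EuclideanSpace ℝ (Fin 3)) (M m mneg P E : ℝ),
        ContDiff ℝ (⊤ : ℕ∞) u₀ ∧ VectorCalculus.IsDivFree u₀ ∧ HasRapidSpatialDecay u₀ ∧
        IsAxisymmetric u₀ ∧ HasNoSwirl u₀ ∧ Integrable (angVortQuot u₀) ∧
        (∫⁻ x, ‖u₀ x‖ₑ ^ 2 ≤ 1) ∧
        (∀ x, |angVortQuot u₀ x| ≤ M) ∧ (∫ x, |angVortQuot u₀ x| ≤ m) ∧ 0 < m ∧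
        (∫⁻ x, ENNReal.ofReal ((angVortQuot u₀ x)⁻) ≤ ENNReal.ofReal mneg) ∧ 0 ≤ mneg ∧ 0 < P ∧
        (∫⁻ x, ENNReal.ofReal (cylRadius x ^ 2 * (angVortQuot u₀ x)⁺) ≤ ENNReal.ofReal P) ∧
        (∫⁻ x, ENNReal.ofReal (cylRadius x ^ 2 * (angVortQuot u₀ x)⁻) ≤ ENNReal.ofReal P) ∧
        0 < E ∧ (ENNReal.ofReal E ≤ ∫⁻ x, ‖u₀ x‖ₑ ^ 2) ∧
        2 * (c * ℓ ^ (2 : ℝ)) * (6 * Real.sqrt (M * Real.sqrt m) * Real.sqrt mneg) ≤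
          Real.sqrt (Real.sqrt (2 * P)) / 2 ∧
        16 * M * P * (c * ℓ ^ (2 : ℝ)) ≤ E ∧
        c * ℓ ^ (-(1 / 2 : ℝ)) ≤
          (π * (E / 2) ^ 3 / (512 * (Real.sqrt m * Real.sqrt (4 * P)) ^ 3)) ^ (1 / 3 : ℝ) ∧
        eLpNorm u₀ 3 volume ≤ ENNReal.ofReal (C₀ * ℓ ^ (-(1 / 2 : ℝ)))) :
    L3PersistenceWithData (1 / 2) 2 := by
  refine ⟨c, C₀, hc, hc1, hC₀, fun ℓ hℓ hℓ1 => ?_⟩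
  obtain ⟨u₀, M, m, mneg, P, E, hsm, hdiv, hdec, hax, hsw, hL1, hE1, hM, hm, hm0, hmneg, hmneg0,
    hP, hPp, hPn, hE, hEu, hW1, hW2, hF, hL3⟩ := hdata ℓ hℓ hℓ1
  obtain ⟨u, p, hsol⟩ := exists_isTaoSolutionOn_of_noSwirl tao2011_smooth_local_existence_holds
    axisymmetricNoSwirl_enstrophy_apriori_holds one_pos hsm hdiv
    (fun n => hdec.lintegral_enorm_iteratedFDeriv_sq_lt_top (μ := volume) n) hax hsw one_pos
  refine ⟨u, p, ⟨?_, ?_, ?_⟩, ?_, ?_, ?_⟩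
  · exact hsol.classical.mono Ico_subset_Icc_self (uniqueDiffOn_Ico 0 1)
  · have := hsol.isLerayHopfOn one_pos
    rwa [← hsol.initial] at this
  · rw [hsol.initial]; exact hdec
  · show ∫⁻ x, ‖u 0 x‖ₑ ^ 2 ≤ 1
    rw [hsol.initial]; exact hE1
  · rw [hsol.initial]; exact hL3
  · intro t ht
    have hℓ2 : 0 < ℓ ^ (2 : ℝ) := Real.rpow_pos_of_pos hℓ _
    have hτpos : 0 < c * ℓ ^ (2 : ℝ) := mul_pos hc hℓ2
    have hτ1 : c * ℓ ^ (2 : ℝ) ≤ 1 := by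
      calc c * ℓ ^ (2 : ℝ) ≤ 1 * 1 :=
            mul_le_mul hc1 (Real.rpow_le_one hℓ.le hℓ1 (by norm_num)) hℓ2.le zero_le_one
        _ = 1 := one_mul _
    have hτ : c * ℓ ^ (2 : ℝ) ∈ Ioc (0 : ℝ) 1 := ⟨hτpos, hτ1⟩
    have htI : t ∈ Icc 0 (c * ℓ ^ (2 : ℝ)) := ⟨ht.1.le, ht.2.le⟩
    have hM0 : 0 ≤ M := (abs_nonneg _).trans (hM 0)
    have htE : 16 * (1 : ℝ) * M * P * t ≤ E := by
      have : 16 * M * P * t ≤ 16 * M * P * (c * ℓ ^ (2 : ℝ)) :=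
        mul_le_mul_of_nonneg_left ht.2.le (by positivity)
      linarith
    have hfl := l3_floor hsol one_pos one_pos hax hsw hL1 hM hm0 hm hmneg hmneg0 hP hPp hPn hτ hW1
      hE hEu htI htE
    exact (ENNReal.ofReal_le_ofReal hF).trans hfl

/-! ### C. The theorem -/

/-- **Ring persistence with controlled data: `L3PersistenceWithData (1/2) 2` holds** (the same
explicit family as `lpPersistence_three_half_two`, data constant `C₀ = (4c_E)^{1/3}`). -/
theorem l3PersistenceWithData_three_half_two : L3PersistenceWithData (1 / 2) 2 := by
  -- the absolute letters `Φ`, `V`, `I₆` and constants `c_E`, `c`, `C₀`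
  obtain ⟨Φ₀, -, hΦ₀⟩ := exists_bound_deriv_smoothTransition
  obtain ⟨Φ, hΦ1, hΦ⟩ : ∃ Φ : ℝ, 1 ≤ Φ ∧ ∀ τ, |deriv Real.smoothTransition τ| ≤ Φ :=
    ⟨max Φ₀ 1, le_max_right _ _, fun τ => (hΦ₀ τ).trans (le_max_left _ _)⟩
  have hΦ0 : 0 < Φ := by linarith
  obtain ⟨V, hVdef⟩ : ∃ V : ℝ, V = (volume (ball (0 : EuclideanSpace ℝ (Fin 3)) 1)).toReal := ⟨_, rfl⟩
  have hV : 0 < V := by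
    rw [hVdef]
    exact ENNReal.toReal_pos (measure_ball_pos volume _ one_pos).ne' measure_ball_lt_top.ne
  set I : ℝ≥0∞ := ∫⁻ y : EuclideanSpace ℝ (Fin 3), ENNReal.ofReal ((1 + ‖y‖) ^ (-(6 : ℝ))) with hIdef
  have hI : I ≠ ⊤ := lintegral_one_add_norm_rpow_neg_six_lt_top.ne
  obtain ⟨i, hidef⟩ : ∃ i : ℝ, i = I.toReal := ⟨_, rfl⟩
  have hi : 0 ≤ i := by rw [hidef]; exact ENNReal.toReal_nonneg
  have hIi : I = ENNReal.ofReal i := by rw [hidef, ENNReal.ofReal_toReal hI]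
  obtain ⟨cE, hcEdef⟩ : ∃ cE : ℝ, cE = 1 / (1 + 6656 * i) := ⟨_, rfl⟩
  have hcE : 0 < cE := by rw [hcEdef]; positivity
  have hcE1 : cE ≤ 1 := by
    rw [hcEdef, div_le_one (by positivity)]; linarith
  obtain ⟨c, hcdef⟩ : ∃ c : ℝ, c = cE / (2 ^ 31 * Φ ^ 4 * (1 + V) ^ 2) := ⟨_, rfl⟩
  obtain ⟨hc0, hc1, -, -, -⟩ := const_bounds hcE hcE1 hΦ1 hV hcdef
  refine l3PersistenceWithData_of_ringData (C₀ := (4 * cE) ^ (1 / 3 : ℝ)) hc0 hc1 (by positivity)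
    fun ℓ hℓ hℓ1 => ?_
  -- `ℓ = t²`, `0 < t ≤ 1`
  obtain ⟨t, ht, ht1, rfl⟩ : ∃ t : ℝ, 0 < t ∧ t ≤ 1 ∧ ℓ = t ^ 2 :=
    ⟨Real.sqrt ℓ, Real.sqrt_pos.2 hℓ, by simpa using Real.sqrt_le_sqrt hℓ1, (Real.sq_sqrt hℓ.le).symm⟩
  have ht0 : t ≠ 0 := ht.ne'
  have hℓ2 : (t ^ 2) ^ (2 : ℝ) = t ^ 4 := by rw [Real.rpow_two]; ring
  have hℓh : (t ^ 2) ^ (-(1 / 2 : ℝ)) = t⁻¹ := by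
    rw [Real.rpow_neg (sq_nonneg t), ← Real.sqrt_eq_rpow, Real.sqrt_sq ht.le]
  -- strength, shape, potential
  obtain ⟨κ, hκ⟩ : ∃ κ : ℝ, κ = cE * t ^ 3 := ⟨_, rfl⟩
  have hκ0 : 0 < κ := by rw [hκ]; positivity
  obtain ⟨G, hG⟩ : ∃ G : ℝ → ℝ, G = fun s => -κ * (Real.smoothTransition (s / t ^ 4 - 1) -
      Real.smoothTransition (s / 16 - 1)) := ⟨_, rfl⟩
  obtain ⟨F, hF⟩ : ∃ F : ℝ → ℝ, F = fun s => ∫ τ in (32 : ℝ)..s, τ ^ (-(5 / 2 : ℝ)) * G τ := ⟨_, rfl⟩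
  obtain ⟨hsm, hdiv, hdec, hax, hsw⟩ := ringDatum_frame hG hF ht ht1
  have hM := ringDatum_abs_eta_le hG hF ht ht1 hκ0.le hΦ
  have ht4 : t ^ 4 ≤ 1 := pow_le_one₀ ht.le ht1
  -- energy `≤ 1`
  have hE1 : ∫⁻ x, ‖curl (fun y : EuclideanSpace ℝ (Fin 3) => F (‖y‖ ^ 2) • rotGen y) x‖ₑ ^ 2 ≤ 1 := by
    refine (ringDatum_energy_le hG hF ht ht1 hκ0.le).trans ?_
    rw [← hIdef, hIi, ← ENNReal.ofReal_mul (by positivity), ← ENNReal.ofReal_one]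
    refine ENNReal.ofReal_le_ofReal ?_
    have e : 6656 / 9 * κ ^ 2 / t ^ 6 * i = 6656 / 9 * cE ^ 2 * i := by
      rw [hκ]; field_simp; try ring
    rw [e]
    exact energy_const_le_one hi hcEdef
  refine ⟨curl fun y : EuclideanSpace ℝ (Fin 3) => F (‖y‖ ^ 2) • rotGen y, 4 * Φ * κ / t ^ 10,
    128 * Φ * κ * V / t ^ 4, Φ * κ * V, 128 * Φ * κ * V, κ ^ 2 * V / (144000 * t ^ 6),
    hsm, hdiv, hdec, hax, hsw, ringDatum_integrable hG hF ht ht1, hE1, hM, ?_, by positivity, ?_,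
    by positivity, by positivity, ?_, ?_, by positivity, ?_, ?_, ?_, ?_, ?_⟩
  · -- mass `m`
    refine (ringDatum_mass_le hG hF ht ht1 hκ0.le hΦ).trans ?_
    rw [← hVdef]
    have h96 : Φ * κ * V ≤ 96 * Φ * κ * V / t ^ 4 := by
      rw [le_div_iff₀ (by positivity)]
      nlinarith [mul_pos (mul_pos hΦ0 hκ0) hV]
    have e : 128 * Φ * κ * V / t ^ 4 = 32 * Φ * κ * V / t ^ 4 + 96 * Φ * κ * V / t ^ 4 := by ring
    rw [e]
    linarith
  · rw [hVdef]; exact ringDatum_negPart_le hG hF ht ht1 hκ0.le hΦ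
  · rw [hVdef]; exact ringDatum_rsq_posPart_le hG hF ht ht1 hκ0.le hΦ
  · rw [hVdef]; exact ringDatum_rsq_negPart_le hG hF ht ht1 hκ0.le hΦ
  · rw [hVdef]; exact ringDatum_energy_ge hG hF ht ht1 hκ0.le
  · rw [hℓ2]; exact scale_window ht ht1 hcE hcE1 hΦ1 hV hcdef hκ
  · rw [hℓ2]; exact scale_energy ht hcE hcE1 hΦ1 hV hcdef
  · rw [hℓh]; exact scale_floor ht hcE hcE1 hΦ1 hV hcdef hκ
  · -- the datum clause `‖u₀‖₃ ≤ (4c_E)^{1/3} t⁻¹ = (4κ/t⁶)^{1/3}`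
    refine (ringDatum_eLpNorm_three_le hG hF ht ht1 hκ0.le hE1).trans (le_of_eq ?_)
    rw [hℓh]
    congr 1
    have e1 : 4 * κ / t ^ 6 = 4 * cE / t ^ 3 := by rw [hκ]; field_simp; try ring
    have e2 : (t ^ 3) ^ (1 / 3 : ℝ) = t := by
      rw [← Real.rpow_natCast, ← Real.rpow_mul ht.le]; norm_num
    rw [e1, Real.div_rpow (by positivity) (by positivity), e2]
    try rw [div_eq_mul_inv]

/-- **Rings calibrate every data-critical jaw (unconditional).**  There are absolute `c, C₀ > 0`
such that for every `ℓ ∈ (0, 1]`, every `q ≥ 0` and every bound `B` admissible for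
`QuantJawData q` on the slice `{ν = T = 1, E₀ ≤ 1, ‖u₀‖₃ ≤ C₀ ℓ^{-1/2}}`:
`B ≥ c^{q+1} ℓ^{-(q/2 − 2)}`.  With `A = C₀ ℓ^{-1/2}`: the modulus of the data-critical jaw grows at
least like `A^{q-4}` — the power saturated by Kato's small-data regime is forced by viscous rings. -/
theorem quantJawData_modulus_lower_ring :
    ∃ c C₀ : ℝ, 0 < c ∧ 0 < C₀ ∧ ∀ ℓ : ℝ, 0 < ℓ → ℓ ≤ 1 → ∀ q : ℝ, 0 ≤ q → ∀ B : NNReal,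
      (∀ (u : ℝ → E3 → E3) (pr : ℝ → E3 → ℝ), IsFrameSolution 1 1 u pr → energy0 u ≤ 1 →
        eLpNorm (u 0) 3 volume ≤ ENNReal.ofReal (C₀ * ℓ ^ (-(1 / 2 : ℝ))) → lpTime 3 q 1 u ≤ B) →
      ENNReal.ofReal (c ^ (q + 1) * ℓ ^ (-(q * (1 / 2) - 2))) ≤ B := by
  obtain ⟨c, C₀, hc, hc1, hC₀, hfam⟩ := l3PersistenceWithData_three_half_two
  refine ⟨c, C₀, hc, hC₀, fun ℓ hℓ hℓ1 q hq B hB => ?_⟩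
  obtain ⟨u, pr, hframe, hE, hdat, hfloor⟩ := hfam ℓ hℓ hℓ1
  have hwin : c * ℓ ^ (2 : ℝ) ≤ 1 := by
    calc c * ℓ ^ (2 : ℝ) ≤ 1 * 1 :=
          mul_le_mul hc1 (Real.rpow_le_one hℓ.le hℓ1 (by norm_num)) (Real.rpow_nonneg hℓ.le _)
            zero_le_one
      _ = 1 := one_mul _
  exact (lpTime_lower_of_floor hq hc hℓ hwin hfloor).trans (hB u pr hframe hE hdat)

/--
info: 'Summit.NavierStokesRegularity.NavierStokesRegularity.Theorems.L3TimeExponentPincerRingPersistenceData.quantJawData_modulus_lower_ring' depends on axioms: [propext,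
 Classical.choice,
 Quot.sound]
-/
#guard_msgs in
#print axioms quantJawData_modulus_lower_ring

end Summit.NavierStokesRegularity.NavierStokesRegularity.Theorems.L3TimeExponentPincerRingPersistenceData
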